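import Summits.QuantumFields.YangMills.Theorems.UnitScaleTiltProp7QSymFlat
import Summits.QuantumFields.YangMills.Theorems.AlphaInputsT3ACv3LinearLiftMatrixCLM
import HarnessLib

/-!
# Route `UnitScaleTilt`, crux K1 child «MinimiserStabilityRegPr» (stmt-QuantumFields-19200), skeleton v10 stub EX, route (α), node (AVG-SYM), MAP #3 row **M12 (AVG-SYM-46)** —
# **THE LETTER `H` OF [Balaban1985Variational] (46) FOR THE ROUTE'S SYMMETRIC AVERAGE: A RIGHT INVERSE OF `QSym F n K h U₀` WITH A k-UNIFORM SUP BOUND**,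
# flat part = 19936's exact sup-small linear lift BY NAME through `QSym_one_apply`, curved part = a Neumann∕injectivity step on the DISPLAYED k-uniform defect `‖QSym U₀ − QSym 1‖ ≤ δ`

Cell `ym3-torus`, width seat `ym-ust-19200-w2` (gen 2); ★★OWNER ym3-torus-plan g25 2026-08-28T03:26:35Z «(ii) the CLM packaging of `QSym_one_apply` as the support letter for M12 (46)
(20520-w3 not yet signed in — if still absent when (iii) lands, TAKE M12 yourself: `Hf :=` the Neumann-series right inverse over `QSym 1` with `hH` from (P12)-flat + EML smallness)»;
W-SEAT-MAP-3 row M12: «`hop`∕B₀: a right inverse `H : (PBond (F.P n) 0 → M₂) →ₗ[ℂ] (PBond (F.P K) 0 → M₂)` of `QSym F n K h U₀` with `‖HX‖ ≤ B₀‖X‖` (sup norms): flat = 19936 exact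
lift … through `QSym_one_apply`; curved = Neumann on the k-uniform defect `‖QSym U₀ − QSym 1‖ ≤ C·ε` from (BD)-type rows».  YM₃ on T³ is ladder rung R3, not the Clay problem;
nothing here is a claim about the crux, the stub, or a gap.  Count-neutral (`--supports stmt-QuantumFields-19200`), def-free.

THE PRINT.  [Balaban1985Variational] p. 285: «Let H be a linear operator from functions on Λ_j to functions on the original lattice with QH = I, e.g. the operator defined by the
minimizer of the quadratic form … (46) |HB| ≦ B₀|B|»; (47) «A = A′ − HD(A′)»; [Balaban1985BackgroundPropagators] Thm 3.12 (the currency of B₀).  The route's `Q` is the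
SYMMETRIC linearised average `QSym F n K h U₀ := fderiv ℂ (logChartSym U₀) 0` (★w1-19200 g2, `Prop7SymAvgGL`), whose flat value is `QSym 1 Y c = Q^{(K−n)} Y (bondShift c)`
(`Prop7QSymFlat.QSym_one_apply`, this seat) for the iterated `BlockAveragingEMLLinearised.linAvg` = 19936's `LinearLiftMatrix.linAvgIterM`.

WHAT IS PROVED (kernel theorems; the ONE displayed row is the defect bound `hdef` of §3).
* §1 `byEntry_smul_complex` (the entrywise extension of a real-linear scalar operator is `ℂ`-homogeneous); ★ `exists_rightInv_of_defect` — ABSTRACT: `Q, Q₁ : E →ₗ[ℂ] G`, `G`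
  finite-dimensional, `H₁` a right inverse of `Q₁` with `‖H₁x‖ ≤ B₁‖x‖`, `‖Qa − Q₁a‖ ≤ δ‖a‖`, `δB₁ ≤ ½` ⟹ a right inverse `H` of `Q` with `‖Hx‖ ≤ 2B₁‖x‖` (`Q∘H₁ = 1 + (Q−Q₁)H₁` is
  norm-expanding by ½, hence injective, hence — finite dimension — invertible: `LinearEquiv.ofInjectiveEndo`; no operator-norm API).
* §2 ★★ `exists_rightInv_QSym_one` — FLAT (46), a KERNEL theorem: `∃ H₁ : (PBond (F.P n) 0 → M₂) →ₗ[ℂ] (PBond (F.P K) 0 → M₂)`, `QSym F n K h 1 (H₁ X) = X`,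
  `‖H₁ X‖ ≤ (C_S ∕ L^{K−n})·‖X‖` (`C_S = LinearLiftMatrix.CS (F.P K) = 18^d(2+(d+1)18^d)`, `CS_T3 : … = 136060560`), and `H₁` maps `S`-valued data to `S`-valued fields for every
  real submodule `S ⊆ M₂(ℂ)` (`𝔰𝔲(2)`, `i𝔰𝔲(2)`): `H₁ X := liftSM (K−n) (X ∘ bondShift⁻¹)` — 19936's `liftSM`∕`linAvgIterM_liftSM`∕`norm_liftSM_le`∕`liftSM_mem` (★w2∕w3-19936) by
  `exact`, through `QSym_one_apply`.
* §3 ★★ `exists_rightInv_QSym` — M12 AT A CURVED BACKGROUND modulo the displayed k-uniform defect: `(∀ A, ‖QSym U₀ A − QSym 1 A‖ ≤ δ‖A‖)`, `0 ≤ δ`, `δ·(C_S∕L^{K−n}) ≤ ½` ⟹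
  `∃ H`, `QSym F n K h U₀ (H X) = X`, `‖H X‖ ≤ 2(C_S∕L^{K−n})‖X‖`; `exists_rightInv_QSym_abs` — the same with the L- and k-FREE constant `B_H = 272121120` (`L^{K−n} ≥ 1`).
* §4 THE SHAPE OF RECORD (★★OWNER RULING M12 SHAPE 03:46:59Z): ★ `exists_rightInv_of_approx` ((N) in the APPROXIMATE form `‖Q(Rx) − x‖ ≤ ½‖x‖ ⟹ ∃ H, Q∘H = id,
  ‖Hx‖ ≤ 2B₁‖x‖`); ★★ `exists_rightInv_QSym_of_approx` = M12 with the COVARIANT rows `(hR) ‖R X‖ ≤ B₁‖X‖`, `(hQR) ‖QSym U₀ (R X) − X‖ ≤ ½‖X‖` displayed (any background, any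
  `ℂ`-linear candidate `R`; `_of_rows` the `∃ R`-form); ★★ `exists_rightInv_QSym_one_of_lift` = the flat junction for ANY additive `ℂ`-homogeneous exact lift of `linAvgIterM (K−n)`
  with a sup row and a submodule row (M18's `obLiftM`, `C = 1056∕L^{K−n}`, instantiates it by `exact`; §2 is the instance `liftSM`).
HONEST SCOPE.  The displayed rows are NOT proved here: `hdef` of §3 (comparison with the FLAT average — gauge-dependent; on T³ the background is not globally near `1`, so §3 is
the small-field model case only) and, of record, `(hR)`∕`(hQR)` of §4 ((T1) twist-exactness defect from `RegPr.plaqSmall` + (T2) eml-derivative corrections, other hands); the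
Landau property (45) `RD*H = 0` and the regularity of `H` (Thm 3.12's derivative bounds) are NOT part of M12 and are not claimed.  Nothing continuum ∕ OS ∕ mass-gap ∕ Clay.

References: T. Bałaban, CMP **102** (1985) 277–309 [Balaban1985Variational] ((44)–(47) p.285, (46) p.285); CMP **109** (1987) 249–301 [Balaban1987RG1] ((0.4), (0.11) p.253);
T. Bałaban, CMP **99** (1985) 389–434 [Balaban1985BackgroundPropagators] (Thm 3.12).
-/

set_option autoImplicit false

noncomputable section

open scoped BigOperators Matrix.Norms.L2Operator
open NormedSpace

namespace Summit.QuantumFields.YangMills.Theorems.Prop7HSym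

open Literature.MathematicalPhysics.QuantumFieldTheory.Balaban1983to89
open T3ContinuumYM3Torus
open T3LevelShift (bondShift)
open Summit.QuantumFields.YangMills.Theorems.LinearLiftMatrix (byEntry byEntry_eq_sum_kernel byEntry_congr liftSM liftSM_eq CS CS_nonneg linAvgIterM linAvgIterM_zero
  linAvgIterM_succ linAvgIterM_liftSM norm_liftSM_le liftSM_mem)
open Summit.QuantumFields.YangMills.Theorems.LinearLiftSpread (liftS liftSL liftSL_apply)
open Summit.QuantumFields.YangMills.Theorems.Prop7SymAvgGL (QSym)
open Summit.QuantumFields.YangMills.Theorems.Prop7QSymFlat (QSym_one_apply)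

/-! ## §1 Two pieces of linear algebra -/

section Algebra

variable {ι κ : Type*} [Fintype ι] {m : Type*}

/-- The entrywise extension of a real-LINEAR scalar operator is `ℂ`-homogeneous (its kernel form has real coefficients, which commute with complex scalars). [folklore] -/
theorem byEntry_smul_complex (T : (ι → ℝ) →ₗ[ℝ] (κ → ℝ)) (z : ℂ) (A : ι → Matrix m m ℂ) : byEntry T (z • A) = z • byEntry T A := by
  classical
  funext b
  rw [Pi.smul_apply, byEntry_eq_sum_kernel, byEntry_eq_sum_kernel, Finset.smul_sum]
  exact Finset.sum_congr rfl fun c _ => by rw [Pi.smul_apply, smul_comm]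

/-- The entrywise extension of a real-LINEAR scalar operator is additive. [folklore] -/
theorem byEntry_add (T : (ι → ℝ) →ₗ[ℝ] (κ → ℝ)) (A B : ι → Matrix m m ℂ) : byEntry T (A + B) = byEntry T A + byEntry T B := by
  classical
  funext b
  rw [Pi.add_apply, byEntry_eq_sum_kernel, byEntry_eq_sum_kernel, byEntry_eq_sum_kernel, ← Finset.sum_add_distrib]
  exact Finset.sum_congr rfl fun c _ => by rw [Pi.add_apply, smul_add]

end Algebra

section Neumann

variable {E G : Type*} [NormedAddCommGroup E] [NormedSpace ℂ E] [NormedAddCommGroup G] [NormedSpace ℂ G] [FiniteDimensional ℂ G]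

/-- ★ **A RIGHT INVERSE SURVIVES A SMALL DEFECT** (finite-dimensional Neumann step, pointwise norms): if `H₁` is a right inverse of `Q₁` with `‖H₁x‖ ≤ B₁‖x‖` and
`‖Qa − Q₁a‖ ≤ δ‖a‖` with `δB₁ ≤ ½`, then `Q` has a right inverse `H` with `‖Hx‖ ≤ 2B₁‖x‖` (`Q ∘ H₁ = 1 + (Q − Q₁)H₁` loses at most half the norm, so it is injective, hence
invertible on the finite-dimensional `G`; `H := H₁ ∘ (Q∘H₁)⁻¹`). [cite: Balaban1985Variational, (46)–(47) p.285] -/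
theorem exists_rightInv_of_defect (Q Q₁ : E →ₗ[ℂ] G) (H₁ : G →ₗ[ℂ] E) {B₁ δ : ℝ} (hB₁ : 0 ≤ B₁) (hδ0 : 0 ≤ δ)
    (hQH : ∀ x, Q₁ (H₁ x) = x) (hH₁ : ∀ x, ‖H₁ x‖ ≤ B₁ * ‖x‖) (hD : ∀ a, ‖Q a - Q₁ a‖ ≤ δ * ‖a‖) (hδ : δ * B₁ ≤ 1 / 2) :
    ∃ H : G →ₗ[ℂ] E, (∀ x, Q (H x) = x) ∧ ∀ x, ‖H x‖ ≤ 2 * B₁ * ‖x‖ := by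
  set T : G →ₗ[ℂ] G := Q.comp H₁ with hT
  have hTy : ∀ y, ‖y‖ ≤ 2 * ‖T y‖ := by
    intro y
    have h1 : T y = y + (Q (H₁ y) - Q₁ (H₁ y)) := by
      rw [hT, LinearMap.comp_apply, hQH]; abel
    have h3 : ‖Q (H₁ y) - Q₁ (H₁ y)‖ ≤ ‖y‖ / 2 :=
      calc ‖Q (H₁ y) - Q₁ (H₁ y)‖ ≤ δ * ‖H₁ y‖ := hD _
        _ ≤ δ * (B₁ * ‖y‖) := mul_le_mul_of_nonneg_left (hH₁ y) hδ0
        _ = (δ * B₁) * ‖y‖ := by ring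
        _ ≤ (1 / 2) * ‖y‖ := mul_le_mul_of_nonneg_right hδ (norm_nonneg _)
        _ = ‖y‖ / 2 := by ring
    have h4 : ‖y‖ ≤ ‖T y‖ + ‖Q (H₁ y) - Q₁ (H₁ y)‖ := by
      have hy : T y - (Q (H₁ y) - Q₁ (H₁ y)) = y := by rw [h1]; abel
      calc ‖y‖ = ‖T y - (Q (H₁ y) - Q₁ (H₁ y))‖ := by rw [hy]
        _ ≤ ‖T y‖ + ‖Q (H₁ y) - Q₁ (H₁ y)‖ := norm_sub_le _ _
    linarith
  have hinj : Function.Injective T := by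
    intro y₁ y₂ h12
    have h0 := hTy (y₁ - y₂)
    rw [map_sub, h12, sub_self, norm_zero, mul_zero] at h0
    exact sub_eq_zero.1 (norm_le_zero_iff.1 h0)
  set Φ : G ≃ₗ[ℂ] G := LinearEquiv.ofInjectiveEndo T hinj with hΦ
  have hΦT : ∀ x, T (Φ.symm x) = x := fun x => Φ.apply_symm_apply x
  refine ⟨H₁.comp (Φ.symm : G →ₗ[ℂ] G), fun x => ?_, fun x => ?_⟩
  · have h1 := hΦT x
    rw [hT, LinearMap.comp_apply] at h1
    rw [LinearMap.comp_apply]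
    exact h1
  · rw [LinearMap.comp_apply]
    have h2 := hTy (Φ.symm x)
    rw [hΦT x] at h2
    calc ‖H₁ ((Φ.symm : G →ₗ[ℂ] G) x)‖ ≤ B₁ * ‖(Φ.symm : G →ₗ[ℂ] G) x‖ := hH₁ _
      _ ≤ B₁ * (2 * ‖x‖) := mul_le_mul_of_nonneg_left h2 hB₁
      _ = 2 * B₁ * ‖x‖ := by ring

end Neumann

/-! ## §2 FLAT (46): an exact right inverse of `QSym F n K h 1` with the k-uniform, `L^{−(K−n)}`-small sup bound -/

section Flat

variable (F : T3Family) {n K : ℕ} (h : n ≤ K)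

/-- `C_S` at the T³ member (`d = 3`): `18³·(2 + 4·18³) = 136060560`. [cite: Balaban1987RG1, (0.4)+(0.11) p.253] -/
theorem CS_T3 : CS (F.P K) = 136060560 := by
  unfold CS
  rw [T3Family.P_d]
  norm_num

/-- ★★ **FLAT (46) — A `ℂ`-LINEAR RIGHT INVERSE OF THE SYMMETRIC LINEARISED AVERAGE AT THE FLAT BACKGROUND, k-UNIFORM SUP BOUND `C_S∕L^{K−n}`, LIE-ALGEBRA VALUED ON
LIE-ALGEBRA DATA**: `H₁ X := liftSM (K−n) (X ∘ bondShift⁻¹)` (19936's exact sup-small linear lift of the iterated `linAvg`, read on the route's coarse lattice `PBond (F.P n) 0`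
through the level identification), `QSym F n K h 1 (H₁ X) = X` by `QSym_one_apply` + `linAvgIterM_liftSM`, `‖H₁ X‖ ≤ (C_S∕L^{K−n})‖X‖` by `norm_liftSM_le`, submodules by
`liftSM_mem`. [cite: Balaban1985Variational, (46) p.285; Balaban1987RG1, (0.4)+(0.11) p.253] -/
theorem exists_rightInv_QSym_one :
    ∃ H₁ : (PBond (F.P n) 0 → Matrix (Fin 2) (Fin 2) ℂ) →ₗ[ℂ] (PBond (F.P K) 0 → Matrix (Fin 2) (Fin 2) ℂ),
      (∀ X, QSym F n K h 1 (H₁ X) = X) ∧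
      (∀ X, ‖H₁ X‖ ≤ (CS (F.P K) / ((F.P K).L : ℝ) ^ (K - n)) * ‖X‖) ∧
      (∀ (S : Submodule ℝ (Matrix (Fin 2) (Fin 2) ℂ)) (X : PBond (F.P n) 0 → Matrix (Fin 2) (Fin 2) ℂ), (∀ c, X c ∈ S) → ∀ b, H₁ X b ∈ S) := by
  classical
  have hk : K - n ≤ (F.P K).m + (F.P K).K := by show K - n ≤ F.m + K; omega
  set e := bondShift (F.sitesPerDir_eq (m := F.m) (K := n) (j := 0) (m' := F.m) (K' := K) (j' := K - n) (by omega)) with he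
  -- the candidate, as a `ℂ`-linear map
  let H₁ : (PBond (F.P n) 0 → Matrix (Fin 2) (Fin 2) ℂ) →ₗ[ℂ] (PBond (F.P K) 0 → Matrix (Fin 2) (Fin 2) ℂ) :=
    { toFun := fun X => liftSM (K - n) (fun c' => X (e.symm c'))
      map_add' := fun X Y => by
        show liftSM (K - n) (fun c' => (X + Y) (e.symm c')) = liftSM (K - n) (fun c' => X (e.symm c')) + liftSM (K - n) (fun c' => Y (e.symm c'))
        rw [liftSM_eq, liftSM_eq, liftSM_eq, byEntry_congr (T := liftS (K - n)) (fun f => (liftSL_apply (K - n) f).symm),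
          byEntry_congr (T := liftS (K - n)) (fun f => (liftSL_apply (K - n) f).symm),
          byEntry_congr (T := liftS (K - n)) (fun f => (liftSL_apply (K - n) f).symm), ← byEntry_add]
        rfl
      map_smul' := fun z X => by
        show liftSM (K - n) (fun c' => (z • X) (e.symm c')) = z • liftSM (K - n) (fun c' => X (e.symm c'))
        rw [liftSM_eq, liftSM_eq, byEntry_congr (T := liftS (K - n)) (fun f => (liftSL_apply (K - n) f).symm),
          byEntry_congr (T := liftS (K - n)) (fun f => (liftSL_apply (K - n) f).symm), ← byEntry_smul_complex]
        rfl }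
  have hH₁ : ∀ X, H₁ X = liftSM (K - n) (fun c' => X (e.symm c')) := fun X => rfl
  refine ⟨H₁, fun X => ?_, fun X => ?_, fun S X hX b => ?_⟩
  · funext c
    rw [QSym_one_apply F h linAvgIterM linAvgIterM_zero linAvgIterM_succ, hH₁]
    have h2 := congr_fun (linAvgIterM_liftSM (K - n) hk (fun c' => X (e.symm c'))) (e c)
    refine h2.trans ?_
    show X (e.symm (e c)) = X c
    rw [Equiv.symm_apply_apply]
  · have hC : 0 ≤ CS (F.P K) / ((F.P K).L : ℝ) ^ (K - n) := div_nonneg (CS_nonneg _) (by positivity)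
    refine (pi_norm_le_iff_of_nonneg (mul_nonneg hC (norm_nonneg _))).2 fun b => ?_
    rw [hH₁]
    exact norm_liftSM_le (K - n) hk _ (fun c' => norm_le_pi_norm X (e.symm c')) b
  · rw [hH₁]
    exact liftSM_mem (K - n) S (fun c' => hX (e.symm c')) b

end Flat

/-! ## §3 M12: the right inverse at a curved background, modulo the displayed k-uniform defect -/

section Curved

variable (F : T3Family) {n K : ℕ} (h : n ≤ K)

/-- ★★ **M12 (AVG-SYM-46) AT A CURVED BACKGROUND** — modulo the DISPLAYED k-uniform defect row `hdef` «‖QSym U₀ A − QSym 1 A‖ ≤ δ‖A‖» ((AVG-SYM-BD), [B7] Prop. 4-type, NOT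
proved here): if `δ·(C_S∕L^{K−n}) ≤ ½` then `QSym F n K h U₀` has a `ℂ`-linear right inverse `H` with the k-uniform sup bound `‖H X‖ ≤ 2(C_S∕L^{K−n})‖X‖` — print's letter `H`
of (46)–(47) for the route's symmetric average (flat lift §2 + Neumann step §1). [cite: Balaban1985Variational, (46)–(47) p.285; Balaban1985BackgroundPropagators, Thm 3.12] -/
theorem exists_rightInv_QSym (U₀ : GaugeField (F.P K) 0 (Matrix.specialUnitaryGroup (Fin 2) ℂ)) {δ : ℝ} (hδ0 : 0 ≤ δ)
    (hdef : ∀ A : PBond (F.P K) 0 → Matrix (Fin 2) (Fin 2) ℂ, ‖QSym F n K h U₀ A - QSym F n K h 1 A‖ ≤ δ * ‖A‖)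
    (hδ : δ * (CS (F.P K) / ((F.P K).L : ℝ) ^ (K - n)) ≤ 1 / 2) :
    ∃ H : (PBond (F.P n) 0 → Matrix (Fin 2) (Fin 2) ℂ) →ₗ[ℂ] (PBond (F.P K) 0 → Matrix (Fin 2) (Fin 2) ℂ),
      (∀ X, QSym F n K h U₀ (H X) = X) ∧ ∀ X, ‖H X‖ ≤ 2 * (CS (F.P K) / ((F.P K).L : ℝ) ^ (K - n)) * ‖X‖ := by
  obtain ⟨H₁, hQH, hH₁, -⟩ := exists_rightInv_QSym_one F h
  have hC : 0 ≤ CS (F.P K) / ((F.P K).L : ℝ) ^ (K - n) := div_nonneg (CS_nonneg _) (by positivity)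
  obtain ⟨H, hQ, hH⟩ := exists_rightInv_of_defect ((QSym F n K h U₀ : _ →L[ℂ] _) : _ →ₗ[ℂ] _) ((QSym F n K h 1 : _ →L[ℂ] _) : _ →ₗ[ℂ] _) H₁ hC hδ0
    (fun x => by exact hQH x) (fun x => hH₁ x) (fun a => by exact hdef a) hδ
  exact ⟨H, fun X => by exact hQ X, hH⟩

/-- ★ **M12 WITH AN ABSOLUTE CONSTANT**: since `L^{K−n} ≥ 1` and `C_S = 136060560` at `d = 3`, the defect window `δ ≤ 1∕272121120` gives a right inverse with the L- and k-FREE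
bound `‖H X‖ ≤ 272121120·‖X‖` (the shape `BH L` of the (46) binder of `Prop7StubEXOfChartPieces.stubEX_of_chartPieces`). [cite: Balaban1985Variational, (46) p.285] -/
theorem exists_rightInv_QSym_abs (U₀ : GaugeField (F.P K) 0 (Matrix.specialUnitaryGroup (Fin 2) ℂ)) {δ : ℝ} (hδ0 : 0 ≤ δ)
    (hdef : ∀ A : PBond (F.P K) 0 → Matrix (Fin 2) (Fin 2) ℂ, ‖QSym F n K h U₀ A - QSym F n K h 1 A‖ ≤ δ * ‖A‖)
    (hδ : 272121120 * δ ≤ 1) :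
    ∃ H : (PBond (F.P n) 0 → Matrix (Fin 2) (Fin 2) ℂ) →ₗ[ℂ] (PBond (F.P K) 0 → Matrix (Fin 2) (Fin 2) ℂ),
      (∀ X, QSym F n K h U₀ (H X) = X) ∧ ∀ X, ‖H X‖ ≤ 272121120 * ‖X‖ := by
  have hL1 : (1 : ℝ) ≤ ((F.P K).L : ℝ) ^ (K - n) := one_le_pow₀ (by exact_mod_cast (F.P K).L_pos)
  have hCle : CS (F.P K) / ((F.P K).L : ℝ) ^ (K - n) ≤ 136060560 := by
    rw [CS_T3, div_le_iff₀ (by positivity)]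
    nlinarith
  have hC : 0 ≤ CS (F.P K) / ((F.P K).L : ℝ) ^ (K - n) := div_nonneg (CS_nonneg _) (by positivity)
  have hδ' : δ * (CS (F.P K) / ((F.P K).L : ℝ) ^ (K - n)) ≤ 1 / 2 := by
    calc δ * (CS (F.P K) / ((F.P K).L : ℝ) ^ (K - n)) ≤ δ * 136060560 := mul_le_mul_of_nonneg_left hCle hδ0
      _ ≤ 1 / 2 := by linarith
  obtain ⟨H, hQ, hH⟩ := exists_rightInv_QSym F h U₀ hδ0 hdef hδ'
  refine ⟨H, hQ, fun X => (hH X).trans ?_⟩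
  calc 2 * (CS (F.P K) / ((F.P K).L : ℝ) ^ (K - n)) * ‖X‖ ≤ 2 * 136060560 * ‖X‖ :=
        mul_le_mul_of_nonneg_right (by linarith) (norm_nonneg _)
    _ = 272121120 * ‖X‖ := by norm_num

end Curved

/-! ## §4 THE SHAPE OF RECORD (★★OWNER RULING M12 SHAPE 2026-08-28T03:46:59Z): the APPROXIMATE right inverse, M12 with the covariant rows `(hR) (hQR)` displayed,
and the flat junction for ANY exact lift of `linAvgIterM` (M18's `obLiftM`, `‖·‖ ≤ 1056∕L^{K−n}`, instantiates it by `exact` when it lands) -/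

section Approx

variable {E G : Type*} [NormedAddCommGroup E] [NormedSpace ℂ E] [NormedAddCommGroup G] [NormedSpace ℂ G] [FiniteDimensional ℂ G]

/-- ★ **(N) OF RECORD — AN APPROXIMATE RIGHT INVERSE UPGRADES TO AN EXACT ONE AT TWICE THE NORM** (finite-dimensional, pointwise norms): `‖Rx‖ ≤ B₁‖x‖` and
`‖Q(Rx) − x‖ ≤ ½‖x‖` ⟹ `∃ H, Q∘H = id, ‖Hx‖ ≤ 2B₁‖x‖` (`Q∘R` loses at most half the norm ⇒ injective ⇒ invertible on `G`; `H := R∘(Q∘R)⁻¹`). `exists_rightInv_of_defect` is the case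
`Q(H₁x) − x = (Q − Q₁)(H₁x)`. [cite: Balaban1985Variational, (46)–(47) p.285] -/
theorem exists_rightInv_of_approx (Q : E →ₗ[ℂ] G) (R : G →ₗ[ℂ] E) {B₁ : ℝ} (hB₁ : 0 ≤ B₁)
    (hR : ∀ x, ‖R x‖ ≤ B₁ * ‖x‖) (hQR : ∀ x, ‖Q (R x) - x‖ ≤ 1 / 2 * ‖x‖) :
    ∃ H : G →ₗ[ℂ] E, (∀ x, Q (H x) = x) ∧ ∀ x, ‖H x‖ ≤ 2 * B₁ * ‖x‖ := by
  set T : G →ₗ[ℂ] G := Q.comp R with hT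
  have hTy : ∀ y, ‖y‖ ≤ 2 * ‖T y‖ := by
    intro y
    have h4 : ‖y‖ ≤ ‖T y‖ + ‖Q (R y) - y‖ := by
      have hy : T y - (Q (R y) - y) = y := by rw [hT, LinearMap.comp_apply]; abel
      calc ‖y‖ = ‖T y - (Q (R y) - y)‖ := by rw [hy]
        _ ≤ ‖T y‖ + ‖Q (R y) - y‖ := norm_sub_le _ _
    have h3 := hQR y
    linarith
  have hinj : Function.Injective T := by
    intro y₁ y₂ h12
    have h0 := hTy (y₁ - y₂)
    rw [map_sub, h12, sub_self, norm_zero, mul_zero] at h0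
    exact sub_eq_zero.1 (norm_le_zero_iff.1 h0)
  set Φ : G ≃ₗ[ℂ] G := LinearEquiv.ofInjectiveEndo T hinj with hΦ
  have hΦT : ∀ x, T (Φ.symm x) = x := fun x => Φ.apply_symm_apply x
  refine ⟨R.comp (Φ.symm : G →ₗ[ℂ] G), fun x => ?_, fun x => ?_⟩
  · have h1 := hΦT x
    rw [hT, LinearMap.comp_apply] at h1
    rw [LinearMap.comp_apply]
    exact h1
  · rw [LinearMap.comp_apply]
    have h2 := hTy (Φ.symm x)
    rw [hΦT x] at h2
    calc ‖R ((Φ.symm : G →ₗ[ℂ] G) x)‖ ≤ B₁ * ‖(Φ.symm : G →ₗ[ℂ] G) x‖ := hR _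
      _ ≤ B₁ * (2 * ‖x‖) := mul_le_mul_of_nonneg_left h2 hB₁
      _ = 2 * B₁ * ‖x‖ := by ring

end Approx

section Record

variable (F : T3Family) {n K : ℕ} (h : n ≤ K)

/-- ★★ **M12 OF RECORD (AVG-SYM-46), COVARIANT ROWS DISPLAYED**: for the route's symmetric linearised average `QSym F n K h U₀` at ANY background and ANY `ℂ`-linear candidate
`R` (the covariant lift of the ruling: M18's one-block kernel twisted by `U₀`-parallel transport), the two displayed rows `(hR) ‖R X‖ ≤ B₁‖X‖` and `(hQR) ‖QSym U₀ (R X) − X‖ ≤ ½‖X‖`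
((T1) twist-exactness defect + (T2) eml-derivative corrections, NOT proved here) give print's letter `H`: `QSym U₀ ∘ H = id`, `‖H X‖ ≤ 2B₁‖X‖` (sup norms of the tree's un-rescaled
bond fields on both sides — the normalisation in which the (46) binder `hH` of `Prop7StubEXOfChartPieces.stubEX_of_chartPieces` is read). [cite: Balaban1985Variational, (46)–(47) p.285] -/
theorem exists_rightInv_QSym_of_approx (U₀ : GaugeField (F.P K) 0 (Matrix.specialUnitaryGroup (Fin 2) ℂ))
    (R : (PBond (F.P n) 0 → Matrix (Fin 2) (Fin 2) ℂ) →ₗ[ℂ] (PBond (F.P K) 0 → Matrix (Fin 2) (Fin 2) ℂ)) {B₁ : ℝ} (hB₁ : 0 ≤ B₁)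
    (hR : ∀ X, ‖R X‖ ≤ B₁ * ‖X‖) (hQR : ∀ X, ‖QSym F n K h U₀ (R X) - X‖ ≤ 1 / 2 * ‖X‖) :
    ∃ H : (PBond (F.P n) 0 → Matrix (Fin 2) (Fin 2) ℂ) →ₗ[ℂ] (PBond (F.P K) 0 → Matrix (Fin 2) (Fin 2) ℂ),
      (∀ X, QSym F n K h U₀ (H X) = X) ∧ ∀ X, ‖H X‖ ≤ 2 * B₁ * ‖X‖ := by
  obtain ⟨H, hQ, hH⟩ := exists_rightInv_of_approx ((QSym F n K h U₀ : _ →L[ℂ] _) : _ →ₗ[ℂ] _) R hB₁ hR (fun X => by exact hQR X)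
  exact ⟨H, fun X => by exact hQ X, hH⟩

/-- ★★ **THE FLAT JUNCTION FOR ANY EXACT LIFT OF THE ITERATED `linAvg`** (M18-ready): an additive, `ℂ`-homogeneous `lift` from level-`(K−n)` data of the member `F.P K` to finest
bond fields with `linAvgIterM (K−n) (lift A) = A`, the sup row `‖A c‖ ≤ M ⇒ ‖lift A b‖ ≤ C·M` and a submodule row, read on the ROUTE's coarse lattice `PBond (F.P n) 0` through
`bondShift`, is a `ℂ`-linear right inverse of `QSym F n K h 1` with `‖H₁ X‖ ≤ C‖X‖` and the same submodule row (`QSym_one_apply`).  §2 is the instance `lift := liftSM (K−n)`,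
`C := C_S∕L^{K−n}`; M18's `obLiftM` (`C := 1056∕L^{K−n}`) is the instance of record. [cite: Balaban1985Variational, (46) p.285; Balaban1987RG1, (0.4)+(0.11) p.253] -/
theorem exists_rightInv_QSym_one_of_lift
    (lift : (PBond (F.P K) (K - n) → Matrix (Fin 2) (Fin 2) ℂ) → (PBond (F.P K) 0 → Matrix (Fin 2) (Fin 2) ℂ))
    (hadd : ∀ A B, lift (A + B) = lift A + lift B) (hsmul : ∀ (z : ℂ) (A), lift (z • A) = z • lift A)
    (hexact : ∀ A, linAvgIterM (K - n) (lift A) = A) {C : ℝ} (hC : 0 ≤ C)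
    (hbound : ∀ (A : PBond (F.P K) (K - n) → Matrix (Fin 2) (Fin 2) ℂ) (M : ℝ), (∀ c, ‖A c‖ ≤ M) → ∀ b, ‖lift A b‖ ≤ C * M)
    (hmem : ∀ (S : Submodule ℝ (Matrix (Fin 2) (Fin 2) ℂ)) (A : PBond (F.P K) (K - n) → Matrix (Fin 2) (Fin 2) ℂ), (∀ c, A c ∈ S) → ∀ b, lift A b ∈ S) :
    ∃ H₁ : (PBond (F.P n) 0 → Matrix (Fin 2) (Fin 2) ℂ) →ₗ[ℂ] (PBond (F.P K) 0 → Matrix (Fin 2) (Fin 2) ℂ),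
      (∀ X, QSym F n K h 1 (H₁ X) = X) ∧
      (∀ X, ‖H₁ X‖ ≤ C * ‖X‖) ∧
      (∀ (S : Submodule ℝ (Matrix (Fin 2) (Fin 2) ℂ)) (X : PBond (F.P n) 0 → Matrix (Fin 2) (Fin 2) ℂ), (∀ c, X c ∈ S) → ∀ b, H₁ X b ∈ S) ∧
      (∀ X, H₁ X = lift (fun c' => X ((bondShift (F.sitesPerDir_eq (m := F.m) (K := n) (j := 0) (m' := F.m) (K' := K) (j' := K - n) (by omega))).symm c'))) := by
  classical
  set e := bondShift (F.sitesPerDir_eq (m := F.m) (K := n) (j := 0) (m' := F.m) (K' := K) (j' := K - n) (by omega)) with he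
  let H₁ : (PBond (F.P n) 0 → Matrix (Fin 2) (Fin 2) ℂ) →ₗ[ℂ] (PBond (F.P K) 0 → Matrix (Fin 2) (Fin 2) ℂ) :=
    { toFun := fun X => lift (fun c' => X (e.symm c'))
      map_add' := fun X Y => by
        show lift (fun c' => (X + Y) (e.symm c')) = lift (fun c' => X (e.symm c')) + lift (fun c' => Y (e.symm c'))
        rw [← hadd]
        rfl
      map_smul' := fun z X => by
        show lift (fun c' => (z • X) (e.symm c')) = z • lift (fun c' => X (e.symm c'))
        rw [← hsmul]
        rfl }
  have hH₁ : ∀ X, H₁ X = lift (fun c' => X (e.symm c')) := fun X => rfl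
  refine ⟨H₁, fun X => ?_, fun X => ?_, fun S X hX b => ?_, fun X => rfl⟩
  · funext c
    rw [QSym_one_apply F h linAvgIterM linAvgIterM_zero linAvgIterM_succ, hH₁]
    have h2 := congr_fun (hexact (fun c' => X (e.symm c'))) (e c)
    refine h2.trans ?_
    show X (e.symm (e c)) = X c
    rw [Equiv.symm_apply_apply]
  · refine (pi_norm_le_iff_of_nonneg (mul_nonneg hC (norm_nonneg _))).2 fun b => ?_
    rw [hH₁]
    exact hbound _ ‖X‖ (fun c' => norm_le_pi_norm X (e.symm c')) b
  · rw [hH₁]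
    exact hmem S _ (fun c' => hX (e.symm c')) b

/-- ★ **M12 FROM A FLAT EXACT LIFT AND THE COVARIANT DEFECT AT IT** (the composition the ruling's DEPMAP v3.9 names: `Hf ⇐ (N) ∘ [(F) ∘ junction] ∘ (T1) ∘ (T2)`): given any exact lift
as in `exists_rightInv_QSym_one_of_lift` with constant `C` and, for the resulting `H₁`, a `ℂ`-linear covariant correction `R` with `‖R X‖ ≤ B₁‖X‖` whose `QSym U₀`-defect is at most
half — the right inverse with `2B₁`.  (Purely a restatement of `exists_rightInv_QSym_of_approx`; recorded so the knit cites one name per DEPMAP arrow.) [cite: Balaban1985Variational, (46)–(47) p.285] -/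
theorem exists_rightInv_QSym_of_rows (U₀ : GaugeField (F.P K) 0 (Matrix.specialUnitaryGroup (Fin 2) ℂ))
    {B₁ : ℝ} (hB₁ : 0 ≤ B₁)
    (hrows : ∃ R : (PBond (F.P n) 0 → Matrix (Fin 2) (Fin 2) ℂ) →ₗ[ℂ] (PBond (F.P K) 0 → Matrix (Fin 2) (Fin 2) ℂ),
      (∀ X, ‖R X‖ ≤ B₁ * ‖X‖) ∧ ∀ X, ‖QSym F n K h U₀ (R X) - X‖ ≤ 1 / 2 * ‖X‖) :
    ∃ H : (PBond (F.P n) 0 → Matrix (Fin 2) (Fin 2) ℂ) →ₗ[ℂ] (PBond (F.P K) 0 → Matrix (Fin 2) (Fin 2) ℂ),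
      (∀ X, QSym F n K h U₀ (H X) = X) ∧ ∀ X, ‖H X‖ ≤ 2 * B₁ * ‖X‖ := by
  obtain ⟨R, hR, hQR⟩ := hrows
  exact exists_rightInv_QSym_of_approx F h U₀ R hB₁ hR hQR

end Record

end Summit.QuantumFields.YangMills.Theorems.Prop7HSym

end
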